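/-
Origin: expansion seat `prover-pub-hodgecm-mc-sinst-1-g5-0`, handover #1223 2026-08-20T11:03Z md5 529e01c6561e (176 l., 7 theorems) NEW additive drop-alone leaf over vendored K-1 only (ArchActQuadraticPlaces, ArchSectionThetaMajorants, UnitaryGroupSeesawConjugation, UnitaryDualPairSplittingDatum, AdelicUnitaryGroup); generic place-slices of archAct for pair / see-saw elements; NAME LIST: HodgeCM.Model.ArchLevi.placeVec_archAct_adelicSeesawConj · HodgeCM.Model.ArchLevi.placeVec_archAct_pair_mul_seesawConj · HodgeCM.Model.ArchLevi.adeleMatAt_archToAdelic (`HOME/mc/pub-hodgecm-mc-sinst-1-g5/stage/HodgeCM/Model/ArchActSlices.lean`, md5 529e01c6561e, 177 lines);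
landed by the second packager p2 gen 7 (p2-g7) in gate run 50 as `HodgeCM/Model/ArchActSlices.lean` (verbatim).
-/
/-
Origin: speedrun cell pub-hodgecm, MODEL-CONSTRUCTION sub-cell, lineage mc-sinst-1 (S-instance constructor, BINDER-OWNERS row 5 `S` / row 6 `μ`: (J-μ) slots 2/3,
(VT) items W1–W3 — the archimedean action of see-saw and pair elements, place by place), seat prover-pub-hodgecm-mc-sinst-1-g5-0 (gen 5), 2026-08-20.
Target in PKG: `HodgeCM/Model/ArchActSlices.lean` (NEW additive drop-alone leaf; imports ONLY vendored K-1 files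
`Weil1964/ArchActQuadraticPlaces`, `Weil1964/ArchSectionThetaMajorants`, `Automorphic/UnitaryGroupSeesawConjugation`, `GelbartRogawski1991/UnitaryDualPairSplittingDatum`,
`Automorphic/AdelicUnitaryGroup`).
KERNEL only: 0 records / `def … : Prop` / cites-as-hypotheses, 0 proof holes; intended closure {propext, Classical.choice, Quot.sound}.
-/
import Literature.NumberTheory.Weil1964.ArchActQuadraticPlaces
import Literature.NumberTheory.Weil1964.ArchSectionThetaMajorants
import Literature.NumberTheory.Automorphic.UnitaryGroupSeesawConjugation
import Literature.NumberTheory.GelbartRogawski1991.UnitaryDualPairSplittingDatum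
import Literature.NumberTheory.Automorphic.AdelicUnitaryGroup

/-!
# `v`-slices of the archimedean action `archAct` for pair elements and see-saw elements (product currency `Fin N × Fin M`)

Generic dictionary lemmas over the vendored `ArchActQuadraticPlaces` (`placeVec_piArch_resEnd`), in the product currency of the
dual pair `U(J_V) × U(J_W)` (Gram `T_V ⊗ₖ T_W`, no `reindex`):

* §1 `archAct_spReindex` — `archAct (reindex e e T) (spReindex e g) = e ∘ archAct T g ∘ e⁻¹` (definitional);
* §2 `placeVec_archAct_adelicPairToSymplectic` — the `v`-slices of `archAct (toSp u)` are `Res_{ℂ/ℝ}(u_w)` (`w ∣ v` complex);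
  `placeVec_archAct_adelicSeesawConj` — for the see-saw element `h₀ = Res(1 ⊗ g) ∘ Λ_C⁻¹` (`UnitaryGroupSeesawConjugation.adelicSeesawConj`)
  they are `Res_{ℂ/ℝ}((1 ⊗ g)_w)` on `(a_v, (C_∞⁻¹ b)_v)`; `placeVec_archAct_pair_mul_seesawConj` — for `toSp u′ · h₀` they are
  `Res_{ℂ/ℝ}(u′_w (1 ⊗ g)_w)` on the same pair (`archAct_mul` + multiplicativity of `resEnd` and of `adeleMatAt`);
* §3 `adeleMatAt_eq_archPart_map` / `adeleMatAt_archToAdelic` (the `w`-component of `x_∞ ∈ U(J)(E ⊗ ℝ) ⊂ U(J)(𝔸_F)` is `x` read at `w`),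
  `adeleMatAt_toAdeleGL` (the `w`-component of `g ⊗ 1` is `σ_w(g)`).

Consumer: `Model/ArchConjLeviShape` (the Levi shape of the conjugated see-saw element at the CM data).  Nothing here is specific to the CM pin;
nothing is a claim of PerL/QW8; nothing is cited as a fact.

References: [Folland1989] G. B. Folland, *Harmonic Analysis in Phase Space*, Princeton UP 1989, Prop. (4.6); [GelbartRogawski1991] §3.1 p. 454;
[Kudla1984] S. Kudla, *Seesaw dual reductive pairs*, §1.
-/

set_option autoImplicit false

noncomputable section

open scoped Matrix Classical Kronecker
open NumberField NumberField.InfinitePlace NumberField.mixedEmbedding IsDedekindDomain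
open Literature.NumberTheory.Automorphic Literature.NumberTheory.Automorphic.UnitaryGroup
open Literature.RepresentationTheory.HeisenbergGroup
open Literature.NumberTheory.Weil1964 Literature.NumberTheory.GelbartRogawski1991

namespace HodgeCM.Model.ArchLevi

/-! ## §1 `archAct` along an index relabelling -/

section Reindex

variable {F : Type} [Field F] [NumberField F] {ι ι' : Type} [Fintype ι] [DecidableEq ι] [Fintype ι'] [DecidableEq ι']
  (T : Matrix ι ι (AdeleRing (𝓞 F) F)) (e : ι ≃ ι')

/-- **`archAct (reindex e e T) (spReindex e g) = e ∘ archAct T g ∘ e⁻¹`** on archimedean pairs. [folklore] -/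
theorem archAct_spReindex (g : symplecticGroup (polar (adelicForm F ι T))) (a w : ι' → mixedSpace F) :
    archAct (Matrix.reindex e e T) (UnitaryGroup.spReindex e T g) (a, w) =
      ((archAct T g (a ∘ e, w ∘ e)).1 ∘ e.symm, (archAct T g (a ∘ e, w ∘ e)).2 ∘ e.symm) := rfl

end Reindex

/-! ## §2 the `v`-slices of `archAct` for the two kinds of elements, product currency `Fin N × Fin M` -/

section Slices

variable (F : Type) [Field F] [NumberField F] (E : Type) [Field E] [NumberField E] [Algebra F E]
  [Algebra.IsQuadraticExtension F E] (c : E ≃ₐ[F] E) (N M : ℕ)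
  {δ : E} (hcδ : c δ = -δ) (hδ : δ ≠ 0) {d : F} (hd : δ * δ = algebraMap F E d)
  {TV : Matrix (Fin N) (Fin N) F} {TW TW' : Matrix (Fin M) (Fin M) F}
  (hV : TV.IsSymm) (hW : TW.IsSymm) (hW' : TW'.IsSymm) {JV : Matrix (Fin N) (Fin N) E} {JW JW' : Matrix (Fin M) (Fin M) E}
  (hJV : JV = TV.map (algebraMap F E)) (hJW : JW = TW.map (algebraMap F E)) (hJW' : JW' = TW'.map (algebraMap F E))
  (v : {v : InfinitePlace F // v.IsReal}) (w : {w : InfinitePlace E // w.IsComplex})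
  (hover : w.1.comap (algebraMap F E) = v.1) (hre : (w.1.embedding δ).re = 0) (him : (w.1.embedding δ).im ≠ 0)

include hover in
/-- **slices of `archAct (toSp u)`, product currency**: `Res_{ℂ/ℝ}(u_w)` on `(a_v, b_v)`. [folklore] -/
theorem placeVec_archAct_adelicPairToSymplectic (u : adelicPair F E c N M JV JW) (a b : Fin N × Fin M → mixedSpace F) :
    (placeVec F (Fin N × Fin M) v (archAct (TV.map (algebraMap F (AdeleRing (𝓞 F) F)) ⊗ₖ TW.map (algebraMap F (AdeleRing (𝓞 F) F)))
        (adelicPairToSymplectic F E c N M hcδ hδ hd hV hW hJV hJW u) (a, b)).1,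
      placeVec F (Fin N × Fin M) v (archAct (TV.map (algebraMap F (AdeleRing (𝓞 F) F)) ⊗ₖ TW.map (algebraMap F (AdeleRing (𝓞 F) F)))
        (adelicPairToSymplectic F E c N M hcδ hδ hd hV hW hJV hJW u) (a, b)).2) =
      (isQuadraticCoordinates_complex (w.1.embedding δ) hre him).resEnd (Fin N × Fin M)
        (adeleMatAt E (Fin N × Fin M) w ((u : GL (Fin N × Fin M) (AdeleRing (𝓞 E) E)) : Matrix (Fin N × Fin M) (Fin N × Fin M) _))
        (placeVec F (Fin N × Fin M) v a, placeVec F (Fin N × Fin M) v b) :=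
  placeVec_piArch_resEnd F E c (Fin N × Fin M) hcδ hδ hd v w hover hre him _ a b

include hover in
/-- **slices of `archAct h₀` for the see-saw element `h₀ = Res(1 ⊗ g) ∘ Λ_C⁻¹`**, product currency:
`Res_{ℂ/ℝ}((1 ⊗ g)_w)` on `(a_v, (C_∞⁻¹ b)_v)`. [folklore] -/
theorem placeVec_archAct_adelicSeesawConj (g : GL (Fin M) (AdeleRing (𝓞 E) E))
    (hg : ((g : Matrix (Fin M) (Fin M) (AdeleRing (𝓞 E) E)).map (conjAdele F E c))ᵀ * adelicForm E M JW * g = adelicForm E M JW')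
    (C : GL (Fin N × Fin M) (AdeleRing (𝓞 F) F))
    (hC : TV.map (algebraMap F (AdeleRing (𝓞 F) F)) ⊗ₖ TW.map (algebraMap F (AdeleRing (𝓞 F) F)) *
        (C : Matrix (Fin N × Fin M) (Fin N × Fin M) (AdeleRing (𝓞 F) F)) =
      TV.map (algebraMap F (AdeleRing (𝓞 F) F)) ⊗ₖ TW'.map (algebraMap F (AdeleRing (𝓞 F) F)))
    (a b : Fin N × Fin M → mixedSpace F) :
    (placeVec F (Fin N × Fin M) v (archAct (TV.map (algebraMap F (AdeleRing (𝓞 F) F)) ⊗ₖ TW.map (algebraMap F (AdeleRing (𝓞 F) F)))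
        (adelicSeesawConj F E c N M hcδ hδ hd hV hW hW' hJV hJW hJW' g hg C hC) (a, b)).1,
      placeVec F (Fin N × Fin M) v (archAct (TV.map (algebraMap F (AdeleRing (𝓞 F) F)) ⊗ₖ TW.map (algebraMap F (AdeleRing (𝓞 F) F)))
        (adelicSeesawConj F E c N M hcδ hδ hd hV hW hW' hJV hJW hJW' g hg C hC) (a, b)).2) =
      (isQuadraticCoordinates_complex (w.1.embedding δ) hre him).resEnd (Fin N × Fin M)
        (adeleMatAt E (Fin N × Fin M) w ((1 : Matrix (Fin N) (Fin N) (AdeleRing (𝓞 E) E)) ⊗ₖ (g : Matrix (Fin M) (Fin M) (AdeleRing (𝓞 E) E))))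
        (placeVec F (Fin N × Fin M) v a,
          placeVec F (Fin N × Fin M) v (archMat F (Fin N × Fin M) ((C⁻¹ : GL (Fin N × Fin M) (AdeleRing (𝓞 F) F)) : Matrix _ _ _) *ᵥ b)) := by
  have key := placeVec_piArch_resEnd F E c (Fin N × Fin M) hcδ hδ hd v w hover hre him
    ((1 : Matrix (Fin N) (Fin N) (AdeleRing (𝓞 E) E)) ⊗ₖ (g : Matrix (Fin M) (Fin M) (AdeleRing (𝓞 E) E))) a
    (archMat F (Fin N × Fin M) ((C⁻¹ : GL (Fin N × Fin M) (AdeleRing (𝓞 F) F)) : Matrix _ _ _) *ᵥ b)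
  rw [← mulVec_archVec] at key
  rw [← key]
  rfl

include hover in
/-- **slices of `archAct (toSp u′ · h₀)`**: `Res_{ℂ/ℝ}(u′_w · (1 ⊗ g)_w)` on `(a_v, (C_∞⁻¹ b)_v)`. [folklore] -/
theorem placeVec_archAct_pair_mul_seesawConj (u' : adelicPair F E c N M JV JW) (g : GL (Fin M) (AdeleRing (𝓞 E) E))
    (hg : ((g : Matrix (Fin M) (Fin M) (AdeleRing (𝓞 E) E)).map (conjAdele F E c))ᵀ * adelicForm E M JW * g = adelicForm E M JW')
    (C : GL (Fin N × Fin M) (AdeleRing (𝓞 F) F))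
    (hC : TV.map (algebraMap F (AdeleRing (𝓞 F) F)) ⊗ₖ TW.map (algebraMap F (AdeleRing (𝓞 F) F)) *
        (C : Matrix (Fin N × Fin M) (Fin N × Fin M) (AdeleRing (𝓞 F) F)) =
      TV.map (algebraMap F (AdeleRing (𝓞 F) F)) ⊗ₖ TW'.map (algebraMap F (AdeleRing (𝓞 F) F)))
    (a b : Fin N × Fin M → mixedSpace F) :
    (placeVec F (Fin N × Fin M) v (archAct (TV.map (algebraMap F (AdeleRing (𝓞 F) F)) ⊗ₖ TW.map (algebraMap F (AdeleRing (𝓞 F) F)))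
        (adelicPairToSymplectic F E c N M hcδ hδ hd hV hW hJV hJW u' *
          adelicSeesawConj F E c N M hcδ hδ hd hV hW hW' hJV hJW hJW' g hg C hC) (a, b)).1,
      placeVec F (Fin N × Fin M) v (archAct (TV.map (algebraMap F (AdeleRing (𝓞 F) F)) ⊗ₖ TW.map (algebraMap F (AdeleRing (𝓞 F) F)))
        (adelicPairToSymplectic F E c N M hcδ hδ hd hV hW hJV hJW u' *
          adelicSeesawConj F E c N M hcδ hδ hd hV hW hW' hJV hJW hJW' g hg C hC) (a, b)).2) =
      (isQuadraticCoordinates_complex (w.1.embedding δ) hre him).resEnd (Fin N × Fin M)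
        (adeleMatAt E (Fin N × Fin M) w (((u' : GL (Fin N × Fin M) (AdeleRing (𝓞 E) E)) : Matrix (Fin N × Fin M) (Fin N × Fin M) _) *
          ((1 : Matrix (Fin N) (Fin N) (AdeleRing (𝓞 E) E)) ⊗ₖ (g : Matrix (Fin M) (Fin M) (AdeleRing (𝓞 E) E)))))
        (placeVec F (Fin N × Fin M) v a,
          placeVec F (Fin N × Fin M) v (archMat F (Fin N × Fin M) ((C⁻¹ : GL (Fin N × Fin M) (AdeleRing (𝓞 F) F)) : Matrix _ _ _) *ᵥ b)) := by
  rw [archAct_mul]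
  set p := archAct (TV.map (algebraMap F (AdeleRing (𝓞 F) F)) ⊗ₖ TW.map (algebraMap F (AdeleRing (𝓞 F) F)))
    (adelicSeesawConj F E c N M hcδ hδ hd hV hW hW' hJV hJW hJW' g hg C hC) (a, b) with hp
  have h1 := placeVec_archAct_adelicPairToSymplectic F E c N M hcδ hδ hd hV hW hJV hJW v w hover hre him u' p.1 p.2
  rw [Prod.mk.eta] at h1
  rw [h1, hp, placeVec_archAct_adelicSeesawConj F E c N M hcδ hδ hd hV hW hW' hJV hJW hJW' v w hover hre him g hg C hC a b]
  simp only [adeleMatAt, Matrix.map_mul, map_mul, Module.End.mul_apply]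

end Slices

/-! ## §3 two matrix dictionaries at a complex place -/

section MatAt

variable (F : Type) [Field F] [NumberField F] (E : Type) [Field E] [NumberField E] [Algebra F E]
  (c : E ≃ₐ[F] E) (M : ℕ) (J : Matrix (Fin M) (Fin M) E) (w : {w : InfinitePlace E // w.IsComplex})

/-- the `w`-component of `u ∈ U(J)(𝔸_F)` is its archimedean part read at `w` (definitional). [folklore] -/
theorem adeleMatAt_eq_archPart_map (u : ↥(UnitaryGroup.adelic F E c M J)) :
    adeleMatAt E (Fin M) w ((u : GL (Fin M) (AdeleRing (𝓞 E) E)) : Matrix (Fin M) (Fin M) (AdeleRing (𝓞 E) E)) =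
      (((UnitaryGroup.archPart F E c M J u : UnitaryGroup.arch F E c M J) : GL (Fin M) (mixedSpace E)) :
        Matrix (Fin M) (Fin M) (mixedSpace E)).map (evalC E w) := rfl

/-- the `w`-component of an archimedean element `x_∞ ∈ U(J)(E ⊗ ℝ)` embedded in `U(J)(𝔸_F)` is `x` read at `w`. [folklore] -/
theorem adeleMatAt_archToAdelic (x : UnitaryGroup.arch F E c M J) :
    adeleMatAt E (Fin M) w ((adelicVal F E c M J (UnitaryGroup.archToAdelic F E c M J x) : GL (Fin M) (AdeleRing (𝓞 E) E)) :
        Matrix (Fin M) (Fin M) (AdeleRing (𝓞 E) E)) =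
      ((x : GL (Fin M) (mixedSpace E)) : Matrix (Fin M) (Fin M) (mixedSpace E)).map (evalC E w) := by
  rw [adelicVal_apply, adeleMatAt_eq_archPart_map, UnitaryGroup.archPart_archToAdelic]

omit [NumberField F] in
/-- the `w`-component of a rational matrix `g ⊗ 1 ∈ GL_M(𝔸_E)` is `σ_w(g)`. [folklore] -/
theorem adeleMatAt_toAdeleGL (g : GL (Fin M) E) :
    adeleMatAt E (Fin M) w ((Literature.NumberTheory.Automorphic.toAdeleGL E g : GL (Fin M) (AdeleRing (𝓞 E) E)) :
        Matrix (Fin M) (Fin M) (AdeleRing (𝓞 E) E)) =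
      (g : Matrix (Fin M) (Fin M) E).map w.1.embedding := by
  ext i j
  rw [adeleMatAt_apply, Literature.NumberTheory.Automorphic.val_toAdeleGL, Matrix.map_apply, AdeleRing.algebraMap_fst_apply, Completion.extensionEmbedding_coe,
    Matrix.map_apply]
  rfl

end MatAt

end HodgeCM.Model.ArchLevi

end
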